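import Literature.AlgebraicGeometry.Resolution.AlterationsSections
import HarnessLib

/-!
# De Jong's alteration theorem: 4.17–4.22a split at 4.17 — (vi) g), a pointed semi-stable model

Topic: `Literature/AlgebraicGeometry/Resolution`. Companion to `AlterationsSections.lean`, which
vendors de Jong 1996, 4.17–4.21 with the first half of 4.22 — from a fibred pair `(X, Z)` with
(i), (iii), (iv), (vi) a)–f) (`DeJong1996.FibredPair f g Z`, `DeJong1996.HasThreeSmoothPoints f Z`,
`DeJong1996.IsUnionOfSections f Z`) to the pointed semi-stable curve
`(𝒞, τ₁(Y) ∪ … ∪ τₙ(Y) ∪ f⁻¹(D))` (`DeJong1996.PreSemiStablePair`) — as ONE named fact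
`DeJong1996SectionsToPreSemiStablePair`. This file cuts it after 4.17, where the text reaches

> "4.17. Assume (i)–(iv), (vi) a)–f). We define an open subscheme `U ⊂ Y` by the formula
> `U = {y ∈ Y | X_y is smooth over y and σᵢ(y) ≠ σⱼ(y) for i ≠ j}`. By (vi) c) we have `U ≠ ∅`.
> Let `g` denote the genus of `f⁻¹(y)` for `y ∈ U`. In view of (vi) e) we have `n ≥ 3` (with `n`
> as in (vi) f)), hence `(X_U, σ₁|_U, …, σₙ|_U)` is a stable `n`-pointed curve of genus `g` over
> `U`. This defines a 1-morphism `U → M_{g,n}` […] Choose `ℓ ≥ 3` prime to the characteristic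
> of `k`. Let `U' ⊂ U ×_{M_{g,n}} ℓM_{g,n}` be an irreducible component; it is finite étale over
> `U` […]. Put `Y'` equal to the closure of `Im(U' → Y ×_k ℓM̄_{g,n})`. It is clear that `Y'` is a
> projective variety over `k` and that `ψ : Y' → Y` is an alteration which is generically étale.
> The smooth stable `n`-pointed curve `(X_U, σ₁|_U, …, σₙ|_U) ×_U U'` extends to a stable
> `n`-pointed curve over `Y'`, see 2.24. […] Replacing `Y` by `Y'` and `X` by `X'` as in 4.15 we
> reduce to a case in which (i)–(iv), (vi) a)–f) hold and
> (vi) g) There exist a stable `n`-pointed curve `(𝒞, τ₁, …, τₙ)` over `Y`, a nonempty open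
> subscheme `U ⊂ Y` and an isomorphism `β : 𝒞_U → X_U` mapping the section `τᵢ|_U` to the
> section `σᵢ|_U`.
> Again we remark that (vi) g) is preserved by operations as in 4.15, by putting
> `𝒞' = 𝒞 ×_Y Y'`, etc." (pp. 71–72)

Accordingly this file

* defines **pointed semi-stable curves** `DeJong1996.IsPointedSemiStableCurve p τ`: a
  semi-stable curve `p : 𝒞 → S` (2.21, `IsSemiStableCurve`) with `n` mutually disjoint sections
  `τᵢ` into the smooth locus of `p` — exactly the part of "stable `n`-pointed curve" (2.24, [16])
  that 4.18–4.28 use (4.20: the labelled points `τᵢ(s)` are pairwise distinct smooth points of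
  the fibre, the fibres are nodal; 4.21: Serre's criterion for the semi-stable `𝒞`; 4.22: "We
  drop the stability hypothesis, since we will not need it any more"; 4.23: "`τᵢ`, `1 ≤ i ≤ n`
  are mutually disjoint sections into the smooth locus of `f`"); Knudsen's genus and stability
  conditions are NOT encoded (they enter the printed proof only inside 4.17, through 2.24);
  proved API: the sections are closed immersions, and the curve of a (pre-)semi-stable pair is a
  pointed semi-stable curve;
* defines property **(vi) g)**, `DeJong1996.HasPointedSemiStableModel f g σ`, for `f : X → Y`
  over `g : Y → Spec k` and sections `σᵢ`: there are an integral `𝒞`, projective over `k`, a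
  pointed semi-stable curve `(p : 𝒞 → Y, τ₁, …, τₙ)`, a non-empty open `U ⊆ Y` and an
  isomorphism `β : 𝒞_U ⥲ X_U` over `Y` with `β ∘ τᵢ|_U = σᵢ|_U` ("stable" weakened to "pointed
  semi-stable" as above; integrality and projectivity of `𝒞` over `k` are the running hypotheses
  (i)/(2.9) and (iii) that "We replace `X` by `𝒞`" in 4.22 keeps — in the text `𝒞` is pulled
  back from the universal curve over the projective scheme `ℓM̄_{g,n}`, 2.24, and `𝒞 ≅ T` is
  integral, 4.18/4.21); and **(vi) f) + g)** with the shared sections `σᵢ`,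
  `DeJong1996.IsUnionOfSectionsWithModel f g Z`; proved API: projections, and non-vacuity — the
  curve of a pre-semi-stable pair is a pointed semi-stable model of itself (`U = Y`, `β = 𝟙`);
* vendors NAMED FACTS `DeJong1996StableModelReduction` (**4.17**: Thm. 4.1 with its
  generically-étale clause for a fibred pair with (vi) e), f) follows from the same for all
  fibred pairs over `k` with (vi) e), f), g) of the same dimension) and
  `DeJong1996StableModelToPreSemiStablePair` (**4.18–4.21 and 4.22 up to the induction
  hypothesis**: Thm. 4.1 with the clause for a fibred pair with (vi) e), f), g) follows from the
  same for all pre-semi-stable pairs over `k` of the same dimension);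
* PROVES the assembly `DeJong1996SectionsToPreSemiStablePair.of_stableModel_of_toPre`, its
  composites down to `DeJong1996NormalProjectiveStepVI`, `DeJong1996StrongAlgClosed` and
  `DeJong1996Strong`, and the sanity implications from `DeJong1996StrongAlgClosed` to each new
  fact.

With "stable" weakened to "pointed semi-stable" in (vi) g), `DeJong1996StableModelReduction` is
implied by the printed 4.17 (its hypothesis quantifies over a larger class of pairs), and
`DeJong1996StableModelToPreSemiStablePair` is what the printed 4.18–4.22 prove (they use no more).
Both are nodes to decompose further: the first needs 2.24 (the projective level-`ℓ` moduli
scheme `ℓM̄_{g,n}` of stable `n`-pointed curves and its universal curve, [16], [6]) and 4.15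
(strict transforms along generically étale projective alterations); the second splits as the
three-point lemma in the general setting of 4.18–4.21 (strict transforms 2.18, flattening 2.19,
Lemma 4.20, Serre's criterion), 4.15 along a modification, and the bookkeeping of 4.22 (4.4
along `β`, 4.9). The owning literature unit's `NOTES.md` keeps the DAG.

## Sources

* A. J. de Jong, *Smoothness, semi-stability and alterations*, Publ. Math. IHÉS 83 (1996) 51–93:
  2.18–2.21, 2.24 (pp. 60–62), Thm. 4.1, 4.4, 4.9 (pp. 66–67), 4.15–4.17 (pp. 71–72),
  4.18–4.22 (pp. 72–75), 4.23 (p. 75).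
-/

noncomputable section

open CategoryTheory CategoryTheory.Limits AlgebraicGeometry TopologicalSpace Topology

namespace Literature.AlgebraicGeometry.Resolution

universe u

namespace DeJong1996

/-! ## Pointed semi-stable curves -/

/-- **Pointed semi-stable curve** — the part of "stable `n`-pointed curve" (de Jong 1996, 2.24,
after Knudsen [16]) used in 4.18–4.28: `p : 𝒞 → S` is a semi-stable curve (2.21: flat, proper,
of finite presentation, geometric fibres connected with at most ordinary double points,
`IsSemiStableCurve`) and `τ₁, …, τₙ` are sections of `p` (`τᵢ ≫ p = 𝟙`) which are mutually
disjoint and land in the smooth locus of `p` (each `τᵢ(S)` lies in an open of `𝒞` on which `p`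
is smooth), as in 4.23: "`τᵢ`, `1 ≤ i ≤ n` are mutually disjoint sections into the smooth locus
of `f`, i.e. `τᵢ : Y → sm(X/Y)`". The arithmetic genus and Knudsen's stability condition (every
nonsingular rational component of a geometric fibre carries at least three special points) are
deliberately not part of the structure. [cite: DeJong1996, 2.21 and 4.23, pp. 61, 75] -/
structure IsPointedSemiStableCurve {C S : Scheme.{u}} (p : C ⟶ S) {n : ℕ}
    (τ : Fin n → (S ⟶ C)) : Prop where
  /-- `p : 𝒞 → S` is a semi-stable curve -/
  isSemiStableCurve : IsSemiStableCurve p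
  /-- the `τᵢ` are sections of `p` -/
  comp_eq_id : ∀ i, τ i ≫ p = 𝟙 S
  /-- the sections are mutually disjoint -/
  pairwise_disjoint : Pairwise fun i j => Disjoint (Set.range (τ i)) (Set.range (τ j))
  /-- the sections map into the smooth locus of `p` -/
  exists_smooth : ∀ i, ∃ V : C.Opens, Set.range (τ i) ⊆ (V : Set C) ∧ Smooth (V.ι ≫ p)

namespace IsPointedSemiStableCurve

variable {C S : Scheme.{u}} {p : C ⟶ S} {n : ℕ} {τ : Fin n → (S ⟶ C)}

/-- The sections of a pointed semi-stable curve are closed immersions (sections of the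
separated `p`). [folklore] -/
theorem isClosedImmersion (h : IsPointedSemiStableCurve p τ) (i : Fin n) :
    IsClosedImmersion (τ i) :=
  haveI := h.isSemiStableCurve.isSeparated
  IsUnionOfSections.isClosedImmersion_of_comp_eq_id (h.comp_eq_id i)

/-- The images `τᵢ(S)` are closed. [folklore] -/
theorem isClosed_range (h : IsPointedSemiStableCurve p τ) (i : Fin n) :
    IsClosed (Set.range (τ i)) :=
  haveI := h.isClosedImmersion i
  (τ i).isClosedEmbedding.isClosed_range

/-- The sections are injective as a family as soon as the base is non-empty (their images are
pairwise disjoint). [folklore] -/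
theorem injective [Nonempty S] (h : IsPointedSemiStableCurve p τ) : Function.Injective τ := by
  intro i j hij
  by_contra hne
  have hd : Disjoint (Set.range (τ i)) (Set.range (τ j)) := h.pairwise_disjoint hne
  rw [hij] at hd
  obtain ⟨s⟩ := ‹Nonempty S›
  exact Set.disjoint_iff.mp hd ⟨⟨s, rfl⟩, ⟨s, rfl⟩⟩

end IsPointedSemiStableCurve

/-- The curve of a pre-semi-stable pair (4.22) with its sections is a pointed semi-stable curve.
[folklore] -/
theorem PreSemiStablePair.isPointedSemiStableCurve {k : Type u} [Field k] {X Y : Scheme.{u}}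
    {f : X ⟶ Y} {g : Y ⟶ Spec (.of k)} {D : Set Y} {n : ℕ} {τ : Fin n → (Y ⟶ X)}
    (h : PreSemiStablePair f g D τ) : IsPointedSemiStableCurve f τ where
  isSemiStableCurve := h.isSemiStableCurve
  comp_eq_id := h.comp_eq_id
  pairwise_disjoint := h.pairwise_disjoint
  exists_smooth := h.exists_smooth

/-- The curve of a pair in Situation 4.23 with its sections is a pointed semi-stable curve.
[folklore] -/
theorem SemiStablePair.isPointedSemiStableCurve {k : Type u} [Field k] {X Y : Scheme.{u}}
    {f : X ⟶ Y} {g : Y ⟶ Spec (.of k)} {D : Set Y} {n : ℕ} {τ : Fin n → (Y ⟶ X)}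
    (h : SemiStablePair f g D τ) : IsPointedSemiStableCurve f τ :=
  h.preSemiStablePair.isPointedSemiStableCurve

/-! ## Property (vi) g) -/

/-- **de Jong 1996, 4.17 (vi) g)** for `f : X → Y` over `g : Y → Spec k` and sections
`σ₁, …, σₙ` of `f`: "There exist a stable `n`-pointed curve `(𝒞, τ₁, …, τₙ)` over `Y`, a
nonempty open subscheme `U ⊂ Y` and an isomorphism `β : 𝒞_U → X_U` mapping the section `τᵢ|_U`
to the section `σᵢ|_U`." Rendered: there are a scheme `𝒞` which is integral and projective over
`k` (the running hypotheses (2.9) and (iii) on "the pair", which 4.22 keeps when "We replace `X`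
by `𝒞`": in the text `𝒞` is the pull-back of the universal curve over the projective scheme
`ℓM̄_{g,n}`, 2.24, and `𝒞 ≅ T` is integral, 4.18 with 4.21), a pointed semi-stable curve
`(p : 𝒞 → Y, τ₁, …, τₙ)` (`IsPointedSemiStableCurve`: "stable `n`-pointed" weakened to what
4.18–4.22 use), a non-empty open `U ⊆ Y`, and an isomorphism `β : p⁻¹(U) ⥲ f⁻¹(U)` of open
subschemes over `Y` (`β ≫ ι ≫ f = ι ≫ p`) such that for each `i` the corestriction
`t : U → p⁻¹(U)` of `τᵢ|_U` satisfies `β ∘ t = σᵢ|_U`. [cite: DeJong1996, 4.17 (vi) g), p. 72] -/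
def HasPointedSemiStableModel {k : Type u} [Field k] {X Y : Scheme.{u}} (f : X ⟶ Y)
    (g : Y ⟶ Spec (.of k)) {n : ℕ} (σ : Fin n → (Y ⟶ X)) : Prop :=
  ∃ (C : Scheme.{u}) (p : C ⟶ Y) (τ : Fin n → (Y ⟶ C)) (U : Y.Opens)
    (β : ((p ⁻¹ᵁ U : C.Opens) : Scheme.{u}) ⟶ (f ⁻¹ᵁ U : X.Opens)),
    IsIntegral C ∧ Literature.AlgebraicGeometry.Motives.IsProjectiveOver (Over.mk (p ≫ g)) ∧
      IsPointedSemiStableCurve p τ ∧ (U : Set Y).Nonempty ∧ IsIso β ∧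
        β ≫ (f ⁻¹ᵁ U).ι ≫ f = (p ⁻¹ᵁ U).ι ≫ p ∧
          ∀ i, ∃ t : (U : Scheme.{u}) ⟶ (p ⁻¹ᵁ U : C.Opens),
            t ≫ (p ⁻¹ᵁ U).ι = U.ι ≫ τ i ∧ t ≫ β ≫ (f ⁻¹ᵁ U).ι = U.ι ≫ σ i

/-- **de Jong 1996, (vi) f) and g) together** for `f : X → Y` over `g : Y → Spec k` and
`Z ⊆ X`: there are pairwise distinct sections `σ₁, …, σₙ` of `f` with `Z = ⋃ᵢ σᵢ(Y)` ((vi) f),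
`IsUnionOfSections`) for which (vi) g) holds (`HasPointedSemiStableModel f g σ`) — the two
properties share the sections `σᵢ` ("an isomorphism `β : 𝒞_U → X_U` mapping the section `τᵢ|_U`
to the section `σᵢ|_U`"). [cite: DeJong1996, 4.16 (vi) f) and 4.17 (vi) g), pp. 71–72] -/
def IsUnionOfSectionsWithModel {k : Type u} [Field k] {X Y : Scheme.{u}} (f : X ⟶ Y)
    (g : Y ⟶ Spec (.of k)) (Z : Set X) : Prop :=
  ∃ (n : ℕ) (σ : Fin n → (Y ⟶ X)), Function.Injective σ ∧ (∀ i, σ i ≫ f = 𝟙 Y) ∧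
    HasPointedSemiStableModel f g σ ∧ Z = ⋃ i, Set.range (σ i)

/-- (vi) f) + g) contains (vi) f). [folklore] -/
theorem IsUnionOfSectionsWithModel.isUnionOfSections {k : Type u} [Field k] {X Y : Scheme.{u}}
    {f : X ⟶ Y} {g : Y ⟶ Spec (.of k)} {Z : Set X} (h : IsUnionOfSectionsWithModel f g Z) :
    IsUnionOfSections f Z := by
  obtain ⟨n, σ, hinj, hσ, -, hZ⟩ := h
  exact ⟨n, σ, hinj, hσ, hZ⟩

/-- (vi) f) + g) from its two parts with shared sections. [folklore] -/
theorem IsUnionOfSectionsWithModel.mk' {k : Type u} [Field k] {X Y : Scheme.{u}} {f : X ⟶ Y}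
    {g : Y ⟶ Spec (.of k)} {Z : Set X} {n : ℕ} {σ : Fin n → (Y ⟶ X)}
    (hinj : Function.Injective σ) (hσ : ∀ i, σ i ≫ f = 𝟙 Y) (hZ : Z = ⋃ i, Set.range (σ i))
    (hmod : HasPointedSemiStableModel f g σ) : IsUnionOfSectionsWithModel f g Z :=
  ⟨n, σ, hinj, hσ, hmod, hZ⟩

namespace HasPointedSemiStableModel

variable {k : Type u} [Field k] {X Y : Scheme.{u}} {f : X ⟶ Y} {g : Y ⟶ Spec (.of k)}

/-- **Non-vacuity of (vi) g): a pointed semi-stable curve is a model of itself.** If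
`(f : X → Y, τ₁, …, τₙ)` is a pointed semi-stable curve with `X` integral and projective over `k`
and `Y` non-empty, then (vi) g) holds for `f` and `σ = τ`, with `𝒞 = X`, `U = Y` and `β = 𝟙`.
[folklore] -/
theorem of_isPointedSemiStableCurve [IsIntegral X] [Nonempty Y] {n : ℕ} {τ : Fin n → (Y ⟶ X)}
    (hproj : Literature.AlgebraicGeometry.Motives.IsProjectiveOver (Over.mk (f ≫ g)))
    (h : IsPointedSemiStableCurve f τ) : HasPointedSemiStableModel f g τ := by
  refine ⟨X, f, τ, ⊤, 𝟙 _, inferInstance, hproj, h, ?_, inferInstance, by simp, fun i => ?_⟩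
  · obtain ⟨y⟩ := ‹Nonempty Y›
    exact ⟨y, trivial⟩
  · -- the corestriction of `τᵢ` to the open `f⁻¹(Y) = X`
    have hsub : Set.range ((⊤ : Y.Opens).ι ≫ τ i) ⊆ Set.range (f ⁻¹ᵁ (⊤ : Y.Opens)).ι := by
      rintro _ ⟨y, rfl⟩
      rw [Scheme.Opens.range_ι]
      trivial
    refine ⟨IsOpenImmersion.lift (f ⁻¹ᵁ ⊤).ι ((⊤ : Y.Opens).ι ≫ τ i) hsub,
      IsOpenImmersion.lift_fac _ _ _, ?_⟩
    rw [Category.id_comp, IsOpenImmersion.lift_fac]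

/-- The curve of a pre-semi-stable pair (4.22) is a pointed semi-stable model of itself.
[folklore] -/
theorem _root_.Literature.AlgebraicGeometry.Resolution.DeJong1996.PreSemiStablePair.hasPointedSemiStableModel
    {D : Set Y} {n : ℕ} {τ : Fin n → (Y ⟶ X)} (h : PreSemiStablePair f g D τ) :
    HasPointedSemiStableModel f g τ := by
  haveI := h.isIntegral
  haveI := h.isIntegral_base
  exact of_isPointedSemiStableCurve h.isProjectiveOver h.isPointedSemiStableCurve

/-- (vi) g) provides, in particular, a non-empty open of the base. [folklore] -/
theorem nonempty {n : ℕ} {σ : Fin n → (Y ⟶ X)} (h : HasPointedSemiStableModel f g σ) :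
    Nonempty Y := by
  obtain ⟨-, -, -, U, -, -, -, -, ⟨y, -⟩, -⟩ := h
  exact ⟨y⟩

end HasPointedSemiStableModel

/-- A pre-semi-stable pair with empty `D` has (vi) f) + g) for its own boundary
`Z = ⋃ᵢ τᵢ(Y)`: the sections are pairwise distinct (disjoint images over the non-empty `Y`) and
the curve is a model of itself. [folklore] -/
theorem PreSemiStablePair.isUnionOfSectionsWithModel {k : Type u} [Field k] {X Y : Scheme.{u}}
    {f : X ⟶ Y} {g : Y ⟶ Spec (.of k)} {n : ℕ} {τ : Fin n → (Y ⟶ X)}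
    (h : PreSemiStablePair f g ∅ τ) :
    IsUnionOfSectionsWithModel f g (semiStableBoundary f ∅ τ) := by
  haveI := h.isIntegral_base
  refine IsUnionOfSectionsWithModel.mk' h.isPointedSemiStableCurve.injective h.comp_eq_id ?_
    h.hasPointedSemiStableModel
  simp [semiStableBoundary]

end DeJong1996

/-! ## 4.17 and 4.18–4.22a as named facts -/

/-- NAMED FACT — **de Jong 1996, 4.17: a stable pointed model over a generically étale
alteration of the base.** Over an algebraically closed field `k`, let `(X, Z)` with
`f : X → Y → Spec k` satisfy (i), (iii), (iv), (vi) a)–d) (`DeJong1996.FibredPair f g Z`), (vi) e)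
(`DeJong1996.HasThreeSmoothPoints f Z`) and (vi) f) (`DeJong1996.IsUnionOfSections f Z`). Then
Thm. 4.1 with its generically-étale clause for `(X → Spec k, Z)` follows from Thm. 4.1 with the
clause for every such pair `(X', Z')` with `f' : X' → Y' → Spec k` over `k` which moreover has
(vi) f) + g) (`DeJong1996.IsUnionOfSectionsWithModel f' g' Z'`: `Z' = ⋃ σᵢ(Y')` for pairwise
distinct sections `σᵢ`, and a pointed semi-stable model `(𝒞, τ)` of `(X', σ)` over a non-empty
open of `Y'`) and `dim X' = dim X`: "`U = {y ∈ Y | X_y is smooth over y and σᵢ(y) ≠ σⱼ(y) for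
i ≠ j}`. By (vi) c) we have `U ≠ ∅`. […] In view of (vi) e) we have `n ≥ 3` […], hence
`(X_U, σ₁|_U, …, σₙ|_U)` is a stable `n`-pointed curve of genus `g` over `U`. This defines a
1-morphism `U → M_{g,n}` […]. Choose `ℓ ≥ 3` prime to the characteristic of `k`. Let
`U' ⊂ U ×_{M_{g,n}} ℓM_{g,n}` be an irreducible component; it is finite étale over `U`, nonempty
[…]. Put `Y'` equal to the closure of `Im(U' → Y ×_k ℓM̄_{g,n})`. It is clear that `Y'` is a
projective variety over `k` and that `ψ : Y' → Y` is an alteration which is generically étale.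
The smooth stable `n`-pointed curve `(X_U, σ₁|_U, …, σₙ|_U) ×_U U'` extends to a stable
`n`-pointed curve over `Y'`, see 2.24. […] Replacing `Y` by `Y'` and `X` by `X'` as in 4.15 we
reduce to a case in which (i)–(iv), (vi) a)–f) hold and (vi) g)". The replacement is along the
generically étale projective alteration `φ : X' → X` of 4.15 (4.4,
`DeJong1996.ConclusionGenericallyEtale.of_isAlteration`), which preserves `dim X` (2.20,
`IsAlteration.topologicalKrullDim_eq`). With "stable" weakened to "pointed semi-stable" in
(vi) g) the class of pairs quantified over is larger, so this is implied by the printed 4.17.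
Users take `(h : DeJong1996StableModelReduction)`; it is a node to decompose further (2.24: the
projective level-`ℓ` moduli scheme of stable `n`-pointed curves and its universal curve; 4.15).
[cite: DeJong1996, 4.17, pp. 71–72] -/
def DeJong1996StableModelReduction : Prop :=
  ∀ (k : Type u) [Field k] [IsAlgClosed k] (X Y : Scheme.{u}) [IsIntegral Y] (f : X ⟶ Y)
    [LocallyOfFinitePresentation f] (g : Y ⟶ Spec (.of k)) (Z : Set X),
    DeJong1996.FibredPair f g Z → DeJong1996.HasThreeSmoothPoints f Z →
      DeJong1996.IsUnionOfSections f Z →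
        (∀ (X' Y' : Scheme.{u}) [IsIntegral Y'] (f' : X' ⟶ Y') [LocallyOfFinitePresentation f']
            (g' : Y' ⟶ Spec (.of k)) (Z' : Set X'),
            DeJong1996.FibredPair f' g' Z' → DeJong1996.HasThreeSmoothPoints f' Z' →
              DeJong1996.IsUnionOfSectionsWithModel f' g' Z' →
                topologicalKrullDim X' = topologicalKrullDim X →
                  DeJong1996.ConclusionGenericallyEtale (f' ≫ g') Z') →
          DeJong1996.ConclusionGenericallyEtale (f ≫ g) Z

/-- NAMED FACT — **de Jong 1996, 4.18–4.21 and 4.22 up to the induction hypothesis: from a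
pointed model to the pointed semi-stable curve `(𝒞, τ₁(Y) ∪ … ∪ τₙ(Y) ∪ f⁻¹(D))`.** Over an
algebraically closed field `k`, let `(X, Z)` with `f : X → Y → Spec k` satisfy (i), (iii), (iv),
(vi) a)–d) (`DeJong1996.FibredPair f g Z`), (vi) e) (`DeJong1996.HasThreeSmoothPoints f Z`) and
(vi) f) + g) (`DeJong1996.IsUnionOfSectionsWithModel f g Z`). Then Thm. 4.1 with its
generically-étale clause for `(X → Spec k, Z)` follows from Thm. 4.1 with the clause for every
pre-semi-stable pair over `k` (`DeJong1996.PreSemiStablePair f' g' D' τ`, boundary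
`⋃ᵢ τᵢ(Y') ∪ f'⁻¹(D')`) of the same dimension as `X`: 4.18–4.21 in the general setting of 4.18
("Suppose we are given a proper morphism `f : X → S` of integral excellent schemes, with
sections `σ₁, …, σₙ` satisfying […] a) […] b) […] c) […] e) […] g) […]. Let us define `T` as the
closure of `Γ_β` in the scheme `𝒞 ×_S X`. […] by [22], see 2.19, we may assume […] h) Both `X`
and `T` […] are flat over `S`. […] i) The scheme `S` is normal. […] 4.20. Lemma [the three-point
lemma] […] 4.21. […] the lemma implies that the morphism `pr₁ : T → 𝒞` has finite fibres, hence
is a finite morphism. We remark that `𝒞` is a normal scheme […] (S₂ + R₁ ⇒ normal). Thus the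
birational finite morphism `pr₁ : T → 𝒞` is an isomorphism. We conclude that the properties
a)–c), e) and g) […] imply that the rational map `β` extends to a birational morphism
`β : 𝒞 → X`, at least after replacing `S` by a modification and `𝒞` and `X` by their strict
transforms."), then 4.22: "We apply the results of 4.18–4.21 and find a modification
`ψ : Y' → Y`, such that `β'` extends. Once again using 4.15 we may replace `Y` by `Y'`, etc., and
assume that `β` extends to `β : 𝒞 → X` and we still have (i)–(iv), (vi) a)–g). […] Thus there is
a closed subset `D ⊂ Y` such that we have `β⁻¹(Z) ⊂ τ₁(Y) ∪ … ∪ τₙ(Y) ∪ f⁻¹(D)` and such that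
`𝒞 → Y` is smooth over `Y ∖ D`. We replace `X` by `𝒞` and `Z` by `τ₁(Y) ∪ … ∪ τₙ(Y) ∪ f⁻¹(D)`,
see 4.4 and 4.9." Only the nodality of the fibres of `𝒞`, the distinctness of the labelled
points and their lying in the smooth locus are used of "stable `n`-pointed" (4.20, Cases 1–2;
4.21), so the printed argument proves the statement with (vi) g) as rendered
(`DeJong1996.HasPointedSemiStableModel`). Every replacement of `(X, Z)` is an enlargement of `Z`
(4.9, `DeJong1996.ConclusionGenericallyEtale.of_subset`) or is along a generically étale
alteration (4.4; the modifications `ψ` and `β` included,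
`DeJong1996.ConclusionGenericallyEtale.of_isBirational_of_conclusion`), which preserves `dim X`
(2.20). Users take `(h : DeJong1996StableModelToPreSemiStablePair)`; it is a node to decompose
further (the three-point lemma 4.18–4.21 with strict transforms 2.18 and flattening 2.19; 4.15
along a modification; the bookkeeping of 4.22). [cite: DeJong1996, 4.18–4.22, pp. 72–74] -/
def DeJong1996StableModelToPreSemiStablePair : Prop :=
  ∀ (k : Type u) [Field k] [IsAlgClosed k] (X Y : Scheme.{u}) [IsIntegral Y] (f : X ⟶ Y)
    [LocallyOfFinitePresentation f] (g : Y ⟶ Spec (.of k)) (Z : Set X),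
    DeJong1996.FibredPair f g Z → DeJong1996.HasThreeSmoothPoints f Z →
      DeJong1996.IsUnionOfSectionsWithModel f g Z →
        (∀ (X' Y' : Scheme.{u}) (f' : X' ⟶ Y') (g' : Y' ⟶ Spec (.of k)) (D' : Set Y') (n : ℕ)
            (τ : Fin n → (Y' ⟶ X')), DeJong1996.PreSemiStablePair f' g' D' τ →
            topologicalKrullDim X' = topologicalKrullDim X →
              DeJong1996.ConclusionGenericallyEtale (f' ≫ g')
                (DeJong1996.semiStableBoundary f' D' τ)) →
          DeJong1996.ConclusionGenericallyEtale (f ≫ g) Z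

/-! ## The assembly -/

/-- **4.17–4.22a from its two parts**: first 4.17 (`DeJong1996StableModelReduction`), then, for
each fibred pair with (vi) e), f), g) of dimension `dim X` so produced, 4.18–4.22a
(`DeJong1996StableModelToPreSemiStablePair`). [cite: DeJong1996, 4.17–4.22, pp. 71–74] -/
theorem DeJong1996SectionsToPreSemiStablePair.of_stableModel_of_toPre
    (h₁ : DeJong1996StableModelReduction.{u}) (h₂ : DeJong1996StableModelToPreSemiStablePair.{u}) :
    DeJong1996SectionsToPreSemiStablePair.{u} := by
  intro k _ _ X Y _ f _ g Z hP h3 hf hS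
  refine h₁ k X Y f g Z hP h3 hf ?_
  intro X' Y' _ f' _ g' Z' hP' h3' hfg' hdim'
  refine h₂ k X' Y' f' g' Z' hP' h3' hfg' ?_
  intro X'' Y'' f'' g'' D'' n τ hpre hdim''
  exact hS X'' Y'' f'' g'' D'' n τ hpre (hdim''.trans hdim')

/-- **4.15–4.22a (`DeJong1996MultisectionToPreSemiStablePair`) from 4.15–4.16, 4.17 and
4.18–4.22a.** [cite: DeJong1996, 4.15–4.22, pp. 71–74] -/
theorem DeJong1996MultisectionToPreSemiStablePair.of_sections_of_stableModel_of_toPre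
    (h₀ : DeJong1996SectionsReduction.{u}) (h₁ : DeJong1996StableModelReduction.{u})
    (h₂ : DeJong1996StableModelToPreSemiStablePair.{u}) :
    DeJong1996MultisectionToPreSemiStablePair.{u} :=
  DeJong1996MultisectionToPreSemiStablePair.of_sections_of_toPre h₀
    (DeJong1996SectionsToPreSemiStablePair.of_stableModel_of_toPre h₁ h₂)

/-- **4.15–4.22 (`DeJong1996MultisectionToSemiStablePair`) from 4.15–4.16, 4.17, 4.18–4.22a and
4.22b.** [cite: DeJong1996, 4.15–4.22, pp. 71–75] -/
theorem DeJong1996MultisectionToSemiStablePair.of_sections_of_stableModel_of_toPre_of_preToSemiStable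
    (h₀ : DeJong1996SectionsReduction.{u}) (h₁ : DeJong1996StableModelReduction.{u})
    (h₂ : DeJong1996StableModelToPreSemiStablePair.{u})
    (h₃ : DeJong1996PreSemiStablePairToSemiStablePair.{u}) :
    DeJong1996MultisectionToSemiStablePair.{u} :=
  DeJong1996MultisectionToSemiStablePair.of_sections_of_toPre_of_preToSemiStable h₀
    (DeJong1996SectionsToPreSemiStablePair.of_stableModel_of_toPre h₁ h₂) h₃

/-- **`DeJong1996NormalProjectiveStepVI` (4.13–4.28) from six named inputs**: 4.14, 4.15–4.16,
4.17, 4.18–4.22a, 4.22b and 4.23–4.28. [cite: DeJong1996, 4.13–4.28, pp. 69–76] -/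
theorem DeJong1996NormalProjectiveStepVI.of_multisection_of_sections_of_stableModel_of_toPre_of_preToSemiStable_of_resolution
    (h14 : DeJong1996MultisectionReduction.{u}) (h₀ : DeJong1996SectionsReduction.{u})
    (h₁ : DeJong1996StableModelReduction.{u}) (h₂ : DeJong1996StableModelToPreSemiStablePair.{u})
    (h₃ : DeJong1996PreSemiStablePairToSemiStablePair.{u})
    (hres : DeJong1996SemiStablePairResolution.{u}) : DeJong1996NormalProjectiveStepVI.{u} :=
  DeJong1996NormalProjectiveStepVI.of_multisection_of_sections_of_toPre_of_preToSemiStable_of_resolution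
    h14 h₀ (DeJong1996SectionsToPreSemiStablePair.of_stableModel_of_toPre h₁ h₂) h₃ hres

/-- Sanity of the cut: `DeJong1996StableModelReduction` is a special case of Thm. 4.1 over
algebraically closed fields (a fibred pair is a pair as in Thm. 4.1). [folklore] -/
theorem DeJong1996StableModelReduction.of_strongAlgClosed (H : DeJong1996StrongAlgClosed.{u}) :
    DeJong1996StableModelReduction.{u} :=
  fun _ _ _ _ _ _ _ _ _ _ hP _ _ _ => hP.conclusionGenericallyEtale_of_strongAlgClosed H

/-- Sanity of the cut: `DeJong1996StableModelToPreSemiStablePair` is a special case of Thm. 4.1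
over algebraically closed fields. [folklore] -/
theorem DeJong1996StableModelToPreSemiStablePair.of_strongAlgClosed
    (H : DeJong1996StrongAlgClosed.{u}) : DeJong1996StableModelToPreSemiStablePair.{u} :=
  fun _ _ _ _ _ _ _ _ _ _ hP _ _ _ => hP.conclusionGenericallyEtale_of_strongAlgClosed H

/-- The induction step 4.6–4.28 (`DeJong1996InductionStep`) from the seven live nodes 4.11–4.12,
4.14, 4.15–4.16, 4.17, 4.18–4.22a, 4.22b, 4.23–4.28. [cite: DeJong1996, 4.6–4.28, pp. 66–76] -/
theorem DeJong1996InductionStep.of_sevenBlocks (h₀ : DeJong1996FibrationReduction.{u})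
    (h14 : DeJong1996MultisectionReduction.{u}) (hS : DeJong1996SectionsReduction.{u})
    (h₁ : DeJong1996StableModelReduction.{u}) (h₂ : DeJong1996StableModelToPreSemiStablePair.{u})
    (h₃ : DeJong1996PreSemiStablePairToSemiStablePair.{u})
    (hres : DeJong1996SemiStablePairResolution.{u}) : DeJong1996InductionStep.{u} :=
  DeJong1996InductionStep.of_sixBlocks h₀ h14 hS
    (DeJong1996SectionsToPreSemiStablePair.of_stableModel_of_toPre h₁ h₂) h₃ hres

/-- **Thm. 4.1 with its generically-étale clause over algebraically closed fields
(`DeJong1996StrongAlgClosed`) from the seven live nodes** 4.11–4.12, 4.14, 4.15–4.16, 4.17,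
4.18–4.22a, 4.22b, 4.23–4.28. [cite: DeJong1996, 4.3–4.28, pp. 66–76] -/
theorem DeJong1996StrongAlgClosed.of_sevenBlocks (h₀ : DeJong1996FibrationReduction.{u})
    (h14 : DeJong1996MultisectionReduction.{u}) (hS : DeJong1996SectionsReduction.{u})
    (h₁ : DeJong1996StableModelReduction.{u}) (h₂ : DeJong1996StableModelToPreSemiStablePair.{u})
    (h₃ : DeJong1996PreSemiStablePairToSemiStablePair.{u})
    (hres : DeJong1996SemiStablePairResolution.{u}) : DeJong1996StrongAlgClosed.{u} :=
  DeJong1996StrongAlgClosed.of_sixBlocks h₀ h14 hS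
    (DeJong1996SectionsToPreSemiStablePair.of_stableModel_of_toPre h₁ h₂) h₃ hres

/-- Thm. 4.1 (i)+(ii) and its last sentence from the limit argument of 4.5
(`DeJong1996.FiniteSubextension45`) and the seven live nodes. [cite: DeJong1996, Thm. 4.1, p. 66] -/
theorem DeJong1996Strong.of_finiteSubextension45_of_sevenBlocks
    (H : DeJong1996.FiniteSubextension45.{u}) (h₀ : DeJong1996FibrationReduction.{u})
    (h14 : DeJong1996MultisectionReduction.{u}) (hS : DeJong1996SectionsReduction.{u})
    (h₁ : DeJong1996StableModelReduction.{u}) (h₂ : DeJong1996StableModelToPreSemiStablePair.{u})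
    (h₃ : DeJong1996PreSemiStablePairToSemiStablePair.{u})
    (hres : DeJong1996SemiStablePairResolution.{u}) :
    DeJong1996Strong.{u} ∧ DeJong1996StrongPerfect.{u} :=
  DeJong1996Strong.of_finiteSubextension45_of_sixBlocks H h₀ h14 hS
    (DeJong1996SectionsToPreSemiStablePair.of_stableModel_of_toPre h₁ h₂) h₃ hres

/-- Thm. 4.1 (i)+(ii) over every field from 4.5 (`DeJong1996Descent`) and the seven live nodes.
[cite: DeJong1996, 4.3–4.28, pp. 66–76] -/
theorem DeJong1996Strong.of_descent_of_sevenBlocks (h45 : DeJong1996Descent.{u})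
    (h₀ : DeJong1996FibrationReduction.{u}) (h14 : DeJong1996MultisectionReduction.{u})
    (hS : DeJong1996SectionsReduction.{u}) (h₁ : DeJong1996StableModelReduction.{u})
    (h₂ : DeJong1996StableModelToPreSemiStablePair.{u})
    (h₃ : DeJong1996PreSemiStablePairToSemiStablePair.{u})
    (hres : DeJong1996SemiStablePairResolution.{u}) : DeJong1996Strong.{u} :=
  DeJong1996Strong.of_descent_of_sixBlocks h45 h₀ h14 hS
    (DeJong1996SectionsToPreSemiStablePair.of_stableModel_of_toPre h₁ h₂) h₃ hres

end Literature.AlgebraicGeometry.Resolution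

end
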